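import Summits.Ventures.YMGap.RobustBall.TierTwoPosWeightSUN
import Summits.Ventures.YMGap.RobustBall.TierTwoMassiveSUN
import HarnessLib

/-!
# Venture YMGap, track ROBUST-BALL (Y2) — EVERY `N ≥ 2` AND EVERY POSITIVE WEIGHT `κ > 0`, tier-2 `ℤ⁴`: EVERY DLR STATE IS MASSIVE

HONEST FRAMING. WHAT THIS IS: a venture file (cell `pub-ymgap`, track Y2 ROBUST-BALL, seat ds-2): the every-`N` MASSIVE schema of
`TierTwoMassiveSUN.lean` with the `κ`-dependent, `N`-uniform far data `farData_posWeightN` (`TierTwoPosWeightSUN.lean`):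
`suN_massive_onBallZdW_star_bakryEmery_posWeight` — under the SAME rational certificate, for EVERY `N ≥ 2`, EVERY weight `κ > 0` and every member `W`
of `MemBallZdW κ ε₀ ε₁` (gauge-invariant summable perturbations of `SU(N)` Wilson on `ℤ⁴` of arbitrary range whose loads are summable against the weight
`e^{κ·diam}`), DLR states of `(N t)·S_W + W` exist and EVERY DLR state is an Osterwalder–Seiler MASSIVE STATE with exponentially decaying
plaquette–plaquette correlations; cells `suN_massive_onBallZdW_star_<64|48|40|36|35|2_69|7_240>_posWeight` and the van Hove reading
`suN_vanHove_massive_star_<cell>_posWeight` (every torus limit state of the periodised family is that massive DLR state). WHAT THIS IS NOT: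
`κ = 0` is not reached; strong-coupling LATTICE statements; radii/rates are door artefacts; nothing about the continuum or the Millennium problem.
-/

noncomputable section

open MeasureTheory Finset Real
open Literature.Probability.LatticeModels
open Literature.MathematicalPhysics.QuantumLattice hiding torusNorm
open Literature.MathematicalPhysics.QuantumFieldTheory hiding ZdEdge
open Literature.MathematicalPhysics.QuantumFieldTheory.Balaban1983to89.StrongCouplingTorusWindow
open Literature.Barriers.QuantumFields (IsMassiveState)
open Summit.QuantumFields.BalabanUV.InfraRed.StrongCouplingPoincareDoorSUN (OneLinkPoincareSUN oneLinkPoincareSUN_bakryEmery)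
open Summit.QuantumFields.BalabanUV.InfraRed.StrongCouplingVarianceDoorSUN (OneLinkVarianceBound oneLinkVarianceBound_bakryEmery)
open Summit.Ventures.YMGap.StarResolventDim (Delta gaugeR doorPoly Delta_pos_of_door gaugeR_lt_one_of_door)
open Summit.Ventures.YMGap.DSWindowZd

namespace Summit.Ventures.YMGap.RobustBall

variable {N : ℕ}

/-! ### The every-`N` massive schema at every weight -/

/-- **SCHEMA, every `N ≥ 2`, EVERY `κ > 0`, TIER-2 `ℤ⁴`, MASSIVE FORM** (certificate of `suN_massGapOnBallZdW_star_bakryEmery` VERBATIM; far data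
`farData_posWeightN`; last step `massive_onBallZdW_of_robustStar_variance`). [folklore] -/
theorem suN_massive_onBallZdW_star_bakryEmery_posWeight (Kn : ℕ) (hN : 2 ≤ N) {κ t ε₀ ε₁ c lam E E₂ s ρ' : ℝ} (hκ : 0 < κ)
    (ht0 : 0 ≤ t)
    (ht : 6 * t < 1 / 2) (hε₁ : 0 ≤ ε₁) (hε₁' : ε₁ ≤ 1 / 2) (hE : Real.exp ε₀ ≤ E) (hE₂ : Real.exp (ε₀ / 2) ≤ E₂)
    (hs : 0 ≤ s) (hqs : 1 ≤ 2 * (1 / 2 - 6 * t) * s ^ 2) (hc : E * (t / (1 / 2 - 6 * t)) ≤ c)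
    (hlam : E₂ * ε₁ * s ≤ lam) (hθ1 : 6 * c + lam < 1) (hcd : doorPoly 4 c < 1)
    (hclose : (10005 / 10000) * (10021 / 10000) * (gaugeR 4 c + (lam + (6 * c + lam) ^ Kn * (16 * lam)) / (1 - (6 * c + lam))) +
      (2002 / 1000) * (5 * (1 / 22026) * ε₁) *
        ((10021 / 10000) * (gaugeR 4 c + (lam + (6 * c + lam) ^ Kn * (16 * lam)) / (1 - (6 * c + lam)))) +
      2 * (2002 / 1000) * (5 * ((1000003 / 1000000) * ((1 / 22026) * (10011 / 10000))) * ε₁) ≤ ρ')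
    (hρ'1 : ρ' < 1) :
    ∀ W : Potential (ZdEdge 4) (SUN N), MemBallZdW κ ε₀ ε₁ W →
      (perturbedGibbsMeasuresS (d := 4) (fundamentalRep (Fin N)) ((N : ℝ) * t) W).Nonempty ∧
        ∀ μ ∈ perturbedGibbsMeasuresS (d := 4) (fundamentalRep (Fin N)) ((N : ℝ) * t) W,
          IsMassiveState μ ∧ HasExponentialDecay (plaquetteCorrFn (fundamentalRep (Fin N)) μ) := by
  intro W hW
  obtain ⟨D, r, hD, hr0, hrκ, hFb, hAb, hE2r, hFar⟩ := farData_posWeightN N hκ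
  have hN1 : 1 ≤ N := by omega
  have hN0 : (0 : ℝ) < N := by exact_mod_cast (show 0 < N by omega)
  have hb : (6 : ℝ) * t < 1 / 2 := ht
  have hgap : 0 < 1 / 2 - 6 * t := by linarith
  have hP := oneLinkPoincareSUN_bakryEmery hN hb
  have hV := oneLinkVarianceBound_bakryEmery hN hb
  obtain ⟨h1, h2⟩ := bakryEmery_star_inputs hN hb hε₁ hE hE₂ hs hqs t ht0
  have htN : |(N : ℝ) * t| / N = t := by rw [abs_of_nonneg (by positivity)]; field_simp
  have hb' : |(N : ℝ) * t| / N * (2 * (((4 : ℕ) : ℝ) - 1)) ≤ 6 * t := by rw [htN]; norm_num; linarith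
  have hc' : Real.exp ε₀ * Real.sqrt (1 / ((N : ℝ) * (1 / 2 - 6 * t)) * ((N : ℝ) / (1 / 2 - 6 * t))) *
      (|(N : ℝ) * t| / N) ≤ c := by
    rw [htN]; exact h1.trans hc
  set θ : ℝ := 6 * c + lam with hθ
  set ρn : ℝ := gaugeR 4 c + (lam + θ ^ Kn * (16 * lam)) / (1 - θ) with hρn
  have hθ' : θ = (2 * ((4 : ℕ) : ℝ) - 2) * c + lam := by rw [hθ]; push_cast; ring
  have hρn' : ρn = gaugeR 4 c + (lam + θ ^ Kn * (4 * ((4 : ℕ) : ℝ) * lam)) / (1 - θ) := by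
    rw [hρn]; push_cast; ring
  -- nonnegativity of the near received sum
  have hE0 : 0 ≤ E := (Real.exp_pos _).le.trans hE
  have hE20 : 0 ≤ E₂ := (Real.exp_pos _).le.trans hE₂
  have hc0 : 0 ≤ c := le_trans (le_trans (by positivity) h1) hc
  have hlam0 : 0 ≤ lam := le_trans (by positivity) hlam
  have hθ0 : 0 ≤ θ := by rw [hθ]; positivity
  have hgR : 0 ≤ gaugeR 4 c := (gaugeR_lt_one_of_door (by norm_num) hc0 hcd).1
  have hρn0 : 0 ≤ ρn := by
    rw [hρn]
    refine add_nonneg hgR (div_nonneg (add_nonneg hlam0 (by positivity)) (by linarith))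
  -- the `N`-dependent far data
  have hSP := two_sqrt_mul_half_pow_le_one N
  have hS0 : 0 ≤ 2 * Real.sqrt (N : ℝ) := by positivity
  have hP0 : 0 < (1 / 2 : ℝ) ^ N := by positivity
  have hτb : (2 * Real.sqrt N) * ((((4 : ℕ) : ℝ) + 1) * Real.exp (-(κ * (D : ℝ))) * ε₁) ≤ 1 / 5000 := by
    have hF := hFb
    calc (2 * Real.sqrt N) * ((((4 : ℕ) : ℝ) + 1) * Real.exp (-(κ * (D : ℝ))) * ε₁)
        ≤ (2 * Real.sqrt N) * ((((4 : ℕ) : ℝ) + 1) * (1 / 22026 * (1 / 2 : ℝ) ^ N) * ε₁) :=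
          mul_le_mul_of_nonneg_left (mul_le_mul_of_nonneg_right (mul_le_mul_of_nonneg_left hF (by positivity)) hε₁) hS0
      _ = (2 * Real.sqrt (N : ℝ) * (1 / 2 : ℝ) ^ N) * (5 / 22026 * ε₁) := by push_cast; ring
      _ ≤ 1 * (5 / 22026 * ε₁) := mul_le_mul_of_nonneg_right hSP (by positivity)
      _ ≤ 1 / 5000 := by linarith
  obtain ⟨hE2, hE24⟩ := exp_tau_w2
  have hA1 := hAb
  have hfar : Real.exp (2 * r) * Real.exp (-((κ - r) * (D : ℝ))) ≤
      (1000003 / 1000000) * ((1 / 22026 * (1 / 2 : ℝ) ^ N) * (10011 / 10000)) :=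
    mul_le_mul hE2r hFar (by positivity) (by norm_num)
  have hA10 : 0 ≤ Real.exp (r * (((max (2 * D) 1 + 2 : ℕ) : ℝ) + 1)) := (Real.exp_pos _).le
  have hG0 : 0 ≤ Real.exp (1 / 5000 : ℝ) ^ 2 + Real.exp (1 / 5000 : ℝ) ^ 4 := by positivity
  -- the inflated closing inequality
  have hclose' : Real.exp (1 / 5000 : ℝ) ^ 2 * Real.exp (r * (((max (2 * D) 1 + 2 : ℕ) : ℝ) + 1)) * ρn +
      (2 * Real.sqrt N) * (Real.exp (1 / 5000 : ℝ) ^ 2 + Real.exp (1 / 5000 : ℝ) ^ 4) *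
        ((((4 : ℕ) : ℝ) + 1) * Real.exp (-(κ * (D : ℝ))) * ε₁) *
        (Real.exp (r * (((max (2 * D) 1 + 2 : ℕ) : ℝ) + 1)) * ρn) +
      2 * (2 * Real.sqrt N) * (Real.exp (1 / 5000 : ℝ) ^ 2 + Real.exp (1 / 5000 : ℝ) ^ 4) *
        ((((4 : ℕ) : ℝ) + 1) * Real.exp (2 * r) * Real.exp (-((κ - r) * (D : ℝ))) * ε₁)
        ≤ ρ' := by
    refine le_trans ?_ hclose
    have hF := hFb
    have hmono : (2 * Real.sqrt N) * (Real.exp (1 / 5000 : ℝ) ^ 2 + Real.exp (1 / 5000 : ℝ) ^ 4) *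
        ((((4 : ℕ) : ℝ) + 1) * Real.exp (-(κ * (D : ℝ))) * ε₁) *
        (Real.exp (r * (((max (2 * D) 1 + 2 : ℕ) : ℝ) + 1)) * ρn) ≤
        (2 * Real.sqrt N) * (Real.exp (1 / 5000 : ℝ) ^ 2 + Real.exp (1 / 5000 : ℝ) ^ 4) *
        ((((4 : ℕ) : ℝ) + 1) * (1 / 22026 * (1 / 2 : ℝ) ^ N) * ε₁) *
        (Real.exp (r * (((max (2 * D) 1 + 2 : ℕ) : ℝ) + 1)) * ρn) :=
      mul_le_mul_of_nonneg_right (mul_le_mul_of_nonneg_left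
        (mul_le_mul_of_nonneg_right (mul_le_mul_of_nonneg_left hF (by positivity)) hε₁) (by positivity)) (by positivity)
    refine le_trans (by linarith [hmono] : _ ≤ Real.exp (1 / 5000 : ℝ) ^ 2 *
        Real.exp (r * (((max (2 * D) 1 + 2 : ℕ) : ℝ) + 1)) * ρn +
      (2 * Real.sqrt N) * (Real.exp (1 / 5000 : ℝ) ^ 2 + Real.exp (1 / 5000 : ℝ) ^ 4) *
        ((((4 : ℕ) : ℝ) + 1) * (1 / 22026 * (1 / 2 : ℝ) ^ N) * ε₁) *
        (Real.exp (r * (((max (2 * D) 1 + 2 : ℕ) : ℝ) + 1)) * ρn) +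
      2 * (2 * Real.sqrt N) * (Real.exp (1 / 5000 : ℝ) ^ 2 + Real.exp (1 / 5000 : ℝ) ^ 4) *
        ((((4 : ℕ) : ℝ) + 1) * Real.exp (2 * r) * Real.exp (-((κ - r) * (D : ℝ))) * ε₁)) ?_
    have h5 : (((4 : ℕ) : ℝ) + 1) = 5 := by norm_num
    rw [h5]
    have hT1 : Real.exp (1 / 5000 : ℝ) ^ 2 * Real.exp (r * (((max (2 * D) 1 + 2 : ℕ) : ℝ) + 1)) * ρn ≤
        (10005 / 10000) * (10021 / 10000) * ρn :=
      mul_le_mul_of_nonneg_right (mul_le_mul hE2 hA1 hA10 (by norm_num)) hρn0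
    have hT2 : (2 * Real.sqrt N) * (Real.exp (1 / 5000 : ℝ) ^ 2 + Real.exp (1 / 5000 : ℝ) ^ 4) *
        ((5 : ℝ) * (1 / 22026 * (1 / 2 : ℝ) ^ N) * ε₁) * (Real.exp (r * (((max (2 * D) 1 + 2 : ℕ) : ℝ) + 1)) * ρn) ≤
        (2002 / 1000) * (5 * (1 / 22026) * ε₁) * ((10021 / 10000) * ρn) := by
      have e1 : (2 * Real.sqrt N) * (Real.exp (1 / 5000 : ℝ) ^ 2 + Real.exp (1 / 5000 : ℝ) ^ 4) *
          ((5 : ℝ) * (1 / 22026 * (1 / 2 : ℝ) ^ N) * ε₁) * (Real.exp (r * (((max (2 * D) 1 + 2 : ℕ) : ℝ) + 1)) * ρn) =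
          (2 * Real.sqrt (N : ℝ) * (1 / 2 : ℝ) ^ N) * ((Real.exp (1 / 5000 : ℝ) ^ 2 + Real.exp (1 / 5000 : ℝ) ^ 4) *
            ((5 * (1 / 22026) * ε₁) * (Real.exp (r * (((max (2 * D) 1 + 2 : ℕ) : ℝ) + 1)) * ρn))) := by ring
      rw [e1]
      have h3 : 0 ≤ 5 * (1 / 22026) * ε₁ := by positivity
      have h2 : Real.exp (r * (((max (2 * D) 1 + 2 : ℕ) : ℝ) + 1)) * ρn ≤ (10021 / 10000) * ρn :=
        mul_le_mul_of_nonneg_right hA1 hρn0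
      have h4 : (Real.exp (1 / 5000 : ℝ) ^ 2 + Real.exp (1 / 5000 : ℝ) ^ 4) *
          ((5 * (1 / 22026) * ε₁) * (Real.exp (r * (((max (2 * D) 1 + 2 : ℕ) : ℝ) + 1)) * ρn)) ≤
          (2002 / 1000) * ((5 * (1 / 22026) * ε₁) * ((10021 / 10000) * ρn)) :=
        mul_le_mul hE24 (mul_le_mul_of_nonneg_left h2 h3) (by positivity) (by norm_num)
      calc (2 * Real.sqrt (N : ℝ) * (1 / 2 : ℝ) ^ N) * ((Real.exp (1 / 5000 : ℝ) ^ 2 + Real.exp (1 / 5000 : ℝ) ^ 4) *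
            ((5 * (1 / 22026) * ε₁) * (Real.exp (r * (((max (2 * D) 1 + 2 : ℕ) : ℝ) + 1)) * ρn)))
          ≤ 1 * ((2002 / 1000) * ((5 * (1 / 22026) * ε₁) * ((10021 / 10000) * ρn))) :=
            mul_le_mul hSP h4 (by positivity) (by norm_num)
        _ = (2002 / 1000) * (5 * (1 / 22026) * ε₁) * ((10021 / 10000) * ρn) := by ring
    have hT3 : 2 * (2 * Real.sqrt N) * (Real.exp (1 / 5000 : ℝ) ^ 2 + Real.exp (1 / 5000 : ℝ) ^ 4) *
        ((5 : ℝ) * Real.exp (2 * r) * Real.exp (-((κ - r) * (D : ℝ))) * ε₁) ≤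
        2 * (2002 / 1000) * (5 * ((1000003 / 1000000) * ((1 / 22026) * (10011 / 10000))) * ε₁) := by
      have hfar' : (5 : ℝ) * Real.exp (2 * r) * Real.exp (-((κ - r) * (D : ℝ))) * ε₁ ≤
          5 * ((1000003 / 1000000) * ((1 / 22026 * (1 / 2 : ℝ) ^ N) * (10011 / 10000))) * ε₁ := by
        rw [show (5 : ℝ) * Real.exp (2 * r) * Real.exp (-((κ - r) * (D : ℝ))) * ε₁ =
          5 * (Real.exp (2 * r) * Real.exp (-((κ - r) * (D : ℝ)))) * ε₁ by ring]
        exact mul_le_mul_of_nonneg_right (mul_le_mul_of_nonneg_left hfar (by norm_num)) hε₁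
      have step1 : 2 * (2 * Real.sqrt N) * (Real.exp (1 / 5000 : ℝ) ^ 2 + Real.exp (1 / 5000 : ℝ) ^ 4) *
          ((5 : ℝ) * Real.exp (2 * r) * Real.exp (-((κ - r) * (D : ℝ))) * ε₁) ≤
          2 * (2 * Real.sqrt N) * (Real.exp (1 / 5000 : ℝ) ^ 2 + Real.exp (1 / 5000 : ℝ) ^ 4) *
          (5 * ((1000003 / 1000000) * ((1 / 22026 * (1 / 2 : ℝ) ^ N) * (10011 / 10000))) * ε₁) :=
        mul_le_mul_of_nonneg_left hfar' (by positivity)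
      refine step1.trans ?_
      have e1 : 2 * (2 * Real.sqrt N) * (Real.exp (1 / 5000 : ℝ) ^ 2 + Real.exp (1 / 5000 : ℝ) ^ 4) *
          (5 * ((1000003 / 1000000) * ((1 / 22026 * (1 / 2 : ℝ) ^ N) * (10011 / 10000))) * ε₁) =
          (2 * Real.sqrt (N : ℝ) * (1 / 2 : ℝ) ^ N) * ((Real.exp (1 / 5000 : ℝ) ^ 2 + Real.exp (1 / 5000 : ℝ) ^ 4) *
            (2 * (5 * ((1000003 / 1000000) * ((1 / 22026) * (10011 / 10000))) * ε₁))) := by ring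
      rw [e1]
      calc (2 * Real.sqrt (N : ℝ) * (1 / 2 : ℝ) ^ N) * ((Real.exp (1 / 5000 : ℝ) ^ 2 + Real.exp (1 / 5000 : ℝ) ^ 4) *
            (2 * (5 * ((1000003 / 1000000) * ((1 / 22026) * (10011 / 10000))) * ε₁)))
          ≤ 1 * ((2002 / 1000) * (2 * (5 * ((1000003 / 1000000) * ((1 / 22026) * (10011 / 10000))) * ε₁))) :=
            mul_le_mul hSP (mul_le_mul_of_nonneg_right hE24 (by positivity)) (by positivity) (by norm_num)
        _ = 2 * (2002 / 1000) * (5 * ((1000003 / 1000000) * ((1 / 22026) * (10011 / 10000))) * ε₁) := by ring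
    linarith
  exact massive_onBallZdW_of_robustStar_variance (N := N) hN1 (D := D) (Kn := Kn)
    hD (by positivity) (by positivity) hb' hP hV hε₁ hc' (h2.trans hlam) hθ' hθ1 hcd hρn'
    hκ hr0 hrκ hτb hclose' (le_trans (by positivity) hclose') hρ'1 hW

/-! ### Cells: every `N ≥ 2`, every `κ > 0` — massive and van Hove -/

/-- **EVERY `N ≥ 2`, EVERY `κ > 0`: every DLR state MASSIVE**, `ℤ⁴`, 't Hooft `1 / 64`, ball `MemBallZdW κ (177 / 500) (177 / 1000)` (certificate of
`suN_massGapOnBallZdW_star_64` verbatim); HYPOTHESIS-FREE. [folklore] -/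
theorem suN_massive_onBallZdW_star_64_posWeight (hN : 2 ≤ N) {κ : ℝ} (hκ : 0 < κ) :
    ∀ W : Potential (ZdEdge 4) (SUN N), MemBallZdW κ (177 / 500) (177 / 1000) W →
      (perturbedGibbsMeasuresS (d := 4) (fundamentalRep (Fin N)) ((N : ℝ) * (1 / 64)) W).Nonempty ∧
        ∀ μ ∈ perturbedGibbsMeasuresS (d := 4) (fundamentalRep (Fin N)) ((N : ℝ) * (1 / 64)) W,
          IsMassiveState μ ∧ HasExponentialDecay (plaquetteCorrFn (fundamentalRep (Fin N)) μ) :=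
  suN_massive_onBallZdW_star_bakryEmery_posWeight 20 hN (κ := κ) (t := 1 / 64) (ε₀ := 177 / 500) (ε₁ := 177 / 1000) (c := 54799 / 1000000)
    (lam := 234387 / 1000000) (E := 712381 / 500000) (E₂ := 37301 / 31250) (s := 554701 / 500000) (ρ' := 999 / 1000)
    hκ (by norm_num) (by norm_num) (by norm_num) (by norm_num) exp_le_177_500_zdw
    (by rw [show (177 / 500 : ℝ) / 2 = 177 / 1000 by norm_num]; exact exp_le_177_1000_zdw) (by norm_num) (by norm_num)
    (by norm_num) (by norm_num) (by norm_num) (by unfold doorPoly; norm_num) (by unfold gaugeR Delta; norm_num) (by norm_num)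

/-- **EVERY `N ≥ 2`, EVERY `κ > 0`: every van Hove limit state is that massive DLR state**, 't Hooft `1 / 64`. [folklore] -/
theorem suN_vanHove_massive_star_64_posWeight (hN : 2 ≤ N) {κ : ℝ} (hκ : 0 < κ) :
    ∀ (W : Potential (ZdEdge 4) (SUN N)) (hW : MemBallZdW κ (177 / 500) (177 / 1000) W),
      ∀ μ ∈ perturbedLimitPoints ((N : ℝ) * (1 / 64)) (periodisedFamilyS W hW.dependsOn hW.gaugeInvariant hW.continuous),
        (∀ ν ∈ perturbedGibbsMeasuresS (d := 4) (fundamentalRep (Fin N)) ((N : ℝ) * (1 / 64)) W, μ = ν) ∧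
          IsMassiveState μ ∧ HasExponentialDecay (plaquetteCorrFn (fundamentalRep (Fin N)) μ) := by
  intro W hW μ hμ
  obtain ⟨⟨ν, hν⟩, hall⟩ := suN_massive_onBallZdW_star_64_posWeight hN hκ W hW
  have hone : ∀ ν' ∈ perturbedGibbsMeasuresS (d := 4) (fundamentalRep (Fin N)) ((N : ℝ) * (1 / 64)) W, μ = ν' := fun ν' hν' =>
    oneState_onBallZdW (suN_massGapOnBallZdW_star_64_posWeight hN hκ) hW hμ hν'
  exact ⟨hone, hall μ ((hone ν hν) ▸ hν)⟩

/-- **EVERY `N ≥ 2`, EVERY `κ > 0`: every DLR state MASSIVE**, `ℤ⁴`, 't Hooft `1 / 48`, ball `MemBallZdW κ (23 / 100) (23 / 200)` (certificate of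
`suN_massGapOnBallZdW_star_48` verbatim); HYPOTHESIS-FREE. [folklore] -/
theorem suN_massive_onBallZdW_star_48_posWeight (hN : 2 ≤ N) {κ : ℝ} (hκ : 0 < κ) :
    ∀ W : Potential (ZdEdge 4) (SUN N), MemBallZdW κ (23 / 100) (23 / 200) W →
      (perturbedGibbsMeasuresS (d := 4) (fundamentalRep (Fin N)) ((N : ℝ) * (1 / 48)) W).Nonempty ∧
        ∀ μ ∈ perturbedGibbsMeasuresS (d := 4) (fundamentalRep (Fin N)) ((N : ℝ) * (1 / 48)) W,
          IsMassiveState μ ∧ HasExponentialDecay (plaquetteCorrFn (fundamentalRep (Fin N)) μ) :=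
  suN_massive_onBallZdW_star_bakryEmery_posWeight 20 hN (κ := κ) (t := 1 / 48) (ε₀ := 23 / 100) (ε₁ := 23 / 200) (c := 69923 / 1000000)
    (lam := 5959 / 40000) (E := 1258601 / 1000000) (E₂ := 560937 / 500000) (s := 577351 / 500000) (ρ' := 999 / 1000)
    hκ (by norm_num) (by norm_num) (by norm_num) (by norm_num) exp_le_23_100_sun
    (by rw [show (23 / 100 : ℝ) / 2 = 23 / 200 by norm_num]; exact exp_le_23_200_sun) (by norm_num) (by norm_num)
    (by norm_num) (by norm_num) (by norm_num) (by unfold doorPoly; norm_num) (by unfold gaugeR Delta; norm_num) (by norm_num)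

/-- **EVERY `N ≥ 2`, EVERY `κ > 0`: every van Hove limit state is that massive DLR state**, 't Hooft `1 / 48`. [folklore] -/
theorem suN_vanHove_massive_star_48_posWeight (hN : 2 ≤ N) {κ : ℝ} (hκ : 0 < κ) :
    ∀ (W : Potential (ZdEdge 4) (SUN N)) (hW : MemBallZdW κ (23 / 100) (23 / 200) W),
      ∀ μ ∈ perturbedLimitPoints ((N : ℝ) * (1 / 48)) (periodisedFamilyS W hW.dependsOn hW.gaugeInvariant hW.continuous),
        (∀ ν ∈ perturbedGibbsMeasuresS (d := 4) (fundamentalRep (Fin N)) ((N : ℝ) * (1 / 48)) W, μ = ν) ∧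
          IsMassiveState μ ∧ HasExponentialDecay (plaquetteCorrFn (fundamentalRep (Fin N)) μ) := by
  intro W hW μ hμ
  obtain ⟨⟨ν, hν⟩, hall⟩ := suN_massive_onBallZdW_star_48_posWeight hN hκ W hW
  have hone : ∀ ν' ∈ perturbedGibbsMeasuresS (d := 4) (fundamentalRep (Fin N)) ((N : ℝ) * (1 / 48)) W, μ = ν' := fun ν' hν' =>
    oneState_onBallZdW (suN_massGapOnBallZdW_star_48_posWeight hN hκ) hW hμ hν'
  exact ⟨hone, hall μ ((hone ν hν) ▸ hν)⟩

/-- **EVERY `N ≥ 2`, EVERY `κ > 0`: every DLR state MASSIVE**, `ℤ⁴`, 't Hooft `1 / 40`, ball `MemBallZdW κ (3 / 25) (3 / 50)` (certificate of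
`suN_massGapOnBallZdW_star_40` verbatim); HYPOTHESIS-FREE. [folklore] -/
theorem suN_massive_onBallZdW_star_40_posWeight (hN : 2 ≤ N) {κ : ℝ} (hκ : 0 < κ) :
    ∀ W : Potential (ZdEdge 4) (SUN N), MemBallZdW κ (3 / 25) (3 / 50) W →
      (perturbedGibbsMeasuresS (d := 4) (fundamentalRep (Fin N)) ((N : ℝ) * (1 / 40)) W).Nonempty ∧
        ∀ μ ∈ perturbedGibbsMeasuresS (d := 4) (fundamentalRep (Fin N)) ((N : ℝ) * (1 / 40)) W,
          IsMassiveState μ ∧ HasExponentialDecay (plaquetteCorrFn (fundamentalRep (Fin N)) μ) :=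
  suN_massive_onBallZdW_star_bakryEmery_posWeight 20 hN (κ := κ) (t := 1 / 40) (ε₀ := 3 / 25) (ε₁ := 3 / 50) (c := 10067 / 125000)
    (lam := 76149 / 1000000) (E := 1127497 / 1000000) (E₂ := 1061837 / 1000000) (s := 119523 / 100000) (ρ' := 999 / 1000)
    hκ (by norm_num) (by norm_num) (by norm_num) (by norm_num) (exp_012_le.trans (by norm_num))
    (by rw [show (3 / 25 : ℝ) / 2 = 3 / 50 by norm_num]; exact exp_le_3_50_sun) (by norm_num) (by norm_num)
    (by norm_num) (by norm_num) (by norm_num) (by unfold doorPoly; norm_num) (by unfold gaugeR Delta; norm_num) (by norm_num)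

/-- **EVERY `N ≥ 2`, EVERY `κ > 0`: every van Hove limit state is that massive DLR state**, 't Hooft `1 / 40`. [folklore] -/
theorem suN_vanHove_massive_star_40_posWeight (hN : 2 ≤ N) {κ : ℝ} (hκ : 0 < κ) :
    ∀ (W : Potential (ZdEdge 4) (SUN N)) (hW : MemBallZdW κ (3 / 25) (3 / 50) W),
      ∀ μ ∈ perturbedLimitPoints ((N : ℝ) * (1 / 40)) (periodisedFamilyS W hW.dependsOn hW.gaugeInvariant hW.continuous),
        (∀ ν ∈ perturbedGibbsMeasuresS (d := 4) (fundamentalRep (Fin N)) ((N : ℝ) * (1 / 40)) W, μ = ν) ∧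
          IsMassiveState μ ∧ HasExponentialDecay (plaquetteCorrFn (fundamentalRep (Fin N)) μ) := by
  intro W hW μ hμ
  obtain ⟨⟨ν, hν⟩, hall⟩ := suN_massive_onBallZdW_star_40_posWeight hN hκ W hW
  have hone : ∀ ν' ∈ perturbedGibbsMeasuresS (d := 4) (fundamentalRep (Fin N)) ((N : ℝ) * (1 / 40)) W, μ = ν' := fun ν' hν' =>
    oneState_onBallZdW (suN_massGapOnBallZdW_star_40_posWeight hN hκ) hW hμ hν'
  exact ⟨hone, hall μ ((hone ν hν) ▸ hν)⟩

/-- **EVERY `N ≥ 2`, EVERY `κ > 0`: every DLR state MASSIVE**, `ℤ⁴`, 't Hooft `1 / 36`, ball `MemBallZdW κ (21 / 500) (21 / 1000)` (certificate of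
`suN_massGapOnBallZdW_star_36` verbatim); HYPOTHESIS-FREE. [folklore] -/
theorem suN_massive_onBallZdW_star_36_posWeight (hN : 2 ≤ N) {κ : ℝ} (hκ : 0 < κ) :
    ∀ W : Potential (ZdEdge 4) (SUN N), MemBallZdW κ (21 / 500) (21 / 1000) W →
      (perturbedGibbsMeasuresS (d := 4) (fundamentalRep (Fin N)) ((N : ℝ) * (1 / 36)) W).Nonempty ∧
        ∀ μ ∈ perturbedGibbsMeasuresS (d := 4) (fundamentalRep (Fin N)) ((N : ℝ) * (1 / 36)) W,
          IsMassiveState μ ∧ HasExponentialDecay (plaquetteCorrFn (fundamentalRep (Fin N)) μ) :=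
  suN_massive_onBallZdW_star_bakryEmery_posWeight 20 hN (κ := κ) (t := 1 / 36) (ε₀ := 21 / 500) (ε₁ := 21 / 1000) (c := 21727 / 250000)
    (lam := 13133 / 500000) (E := 208579 / 200000) (E₂ := 1021223 / 1000000) (s := 612373 / 500000) (ρ' := 999 / 1000)
    hκ (by norm_num) (by norm_num) (by norm_num) (by norm_num) exp_le_21_500_cstar3w
    (by rw [show (21 / 500 : ℝ) / 2 = 21 / 1000 by norm_num]; exact exp_le_21_1000_zdw) (by norm_num) (by norm_num)
    (by norm_num) (by norm_num) (by norm_num) (by unfold doorPoly; norm_num) (by unfold gaugeR Delta; norm_num) (by norm_num)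

/-- **EVERY `N ≥ 2`, EVERY `κ > 0`: every van Hove limit state is that massive DLR state**, 't Hooft `1 / 36`. [folklore] -/
theorem suN_vanHove_massive_star_36_posWeight (hN : 2 ≤ N) {κ : ℝ} (hκ : 0 < κ) :
    ∀ (W : Potential (ZdEdge 4) (SUN N)) (hW : MemBallZdW κ (21 / 500) (21 / 1000) W),
      ∀ μ ∈ perturbedLimitPoints ((N : ℝ) * (1 / 36)) (periodisedFamilyS W hW.dependsOn hW.gaugeInvariant hW.continuous),
        (∀ ν ∈ perturbedGibbsMeasuresS (d := 4) (fundamentalRep (Fin N)) ((N : ℝ) * (1 / 36)) W, μ = ν) ∧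
          IsMassiveState μ ∧ HasExponentialDecay (plaquetteCorrFn (fundamentalRep (Fin N)) μ) := by
  intro W hW μ hμ
  obtain ⟨⟨ν, hν⟩, hall⟩ := suN_massive_onBallZdW_star_36_posWeight hN hκ W hW
  have hone : ∀ ν' ∈ perturbedGibbsMeasuresS (d := 4) (fundamentalRep (Fin N)) ((N : ℝ) * (1 / 36)) W, μ = ν' := fun ν' hν' =>
    oneState_onBallZdW (suN_massGapOnBallZdW_star_36_posWeight hN hκ) hW hμ hν'
  exact ⟨hone, hall μ ((hone ν hν) ▸ hν)⟩

/-- **EVERY `N ≥ 2`, EVERY `κ > 0`: every DLR state MASSIVE**, `ℤ⁴`, 't Hooft `1 / 35`, ball `MemBallZdW κ (2 / 125) (1 / 125)` (certificate of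
`suN_massGapOnBallZdW_star_35` verbatim); HYPOTHESIS-FREE. [folklore] -/
theorem suN_massive_onBallZdW_star_35_posWeight (hN : 2 ≤ N) {κ : ℝ} (hκ : 0 < κ) :
    ∀ W : Potential (ZdEdge 4) (SUN N), MemBallZdW κ (2 / 125) (1 / 125) W →
      (perturbedGibbsMeasuresS (d := 4) (fundamentalRep (Fin N)) ((N : ℝ) * (1 / 35)) W).Nonempty ∧
        ∀ μ ∈ perturbedGibbsMeasuresS (d := 4) (fundamentalRep (Fin N)) ((N : ℝ) * (1 / 35)) W,
          IsMassiveState μ ∧ HasExponentialDecay (plaquetteCorrFn (fundamentalRep (Fin N)) μ) :=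
  suN_massive_onBallZdW_star_bakryEmery_posWeight 20 hN (κ := κ) (t := 1 / 35) (ε₀ := 2 / 125) (ε₁ := 1 / 125) (c := 2209 / 25000)
    (lam := 2487 / 250000)
    (E := 99231317 / 97656250) (E₂ := 4725150401 / 4687500000) (s := 308397 / 250000) (ρ' := 999 / 1000)
    hκ (by norm_num) (by norm_num) (by norm_num) (by norm_num) ((exp_le_taylor4 (x := 2 / 125) (by norm_num) (by norm_num)).trans (by norm_num))
    (by rw [show (2 / 125 : ℝ) / 2 = 1 / 125 by norm_num]; exact (exp_le_taylor4 (x := 1 / 125) (by norm_num) (by norm_num)).trans (by norm_num))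
    (by norm_num) (by norm_num) (by norm_num) (by norm_num) (by norm_num) (by unfold doorPoly; norm_num) (by unfold gaugeR Delta; norm_num) (by norm_num)

/-- **EVERY `N ≥ 2`, EVERY `κ > 0`: every van Hove limit state is that massive DLR state**, 't Hooft `1 / 35`. [folklore] -/
theorem suN_vanHove_massive_star_35_posWeight (hN : 2 ≤ N) {κ : ℝ} (hκ : 0 < κ) :
    ∀ (W : Potential (ZdEdge 4) (SUN N)) (hW : MemBallZdW κ (2 / 125) (1 / 125) W),
      ∀ μ ∈ perturbedLimitPoints ((N : ℝ) * (1 / 35)) (periodisedFamilyS W hW.dependsOn hW.gaugeInvariant hW.continuous),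
        (∀ ν ∈ perturbedGibbsMeasuresS (d := 4) (fundamentalRep (Fin N)) ((N : ℝ) * (1 / 35)) W, μ = ν) ∧
          IsMassiveState μ ∧ HasExponentialDecay (plaquetteCorrFn (fundamentalRep (Fin N)) μ) := by
  intro W hW μ hμ
  obtain ⟨⟨ν, hν⟩, hall⟩ := suN_massive_onBallZdW_star_35_posWeight hN hκ W hW
  have hone : ∀ ν' ∈ perturbedGibbsMeasuresS (d := 4) (fundamentalRep (Fin N)) ((N : ℝ) * (1 / 35)) W, μ = ν' := fun ν' hν' =>
    oneState_onBallZdW (suN_massGapOnBallZdW_star_35_posWeight hN hκ) hW hμ hν'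
  exact ⟨hone, hall μ ((hone ν hν) ▸ hν)⟩

/-- **EVERY `N ≥ 2`, EVERY `κ > 0`: every DLR state MASSIVE**, `ℤ⁴`, 't Hooft `2 / 69`, ball `MemBallZdW κ (1 / 250) (1 / 500)` (certificate of
`suN_massGapOnBallZdW_star_2_69` verbatim); HYPOTHESIS-FREE. [folklore] -/
theorem suN_massive_onBallZdW_star_2_69_posWeight (hN : 2 ≤ N) {κ : ℝ} (hκ : 0 < κ) :
    ∀ W : Potential (ZdEdge 4) (SUN N), MemBallZdW κ (1 / 250) (1 / 500) W →
      (perturbedGibbsMeasuresS (d := 4) (fundamentalRep (Fin N)) ((N : ℝ) * (2 / 69)) W).Nonempty ∧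
        ∀ μ ∈ perturbedGibbsMeasuresS (d := 4) (fundamentalRep (Fin N)) ((N : ℝ) * (2 / 69)) W,
          IsMassiveState μ ∧ HasExponentialDecay (plaquetteCorrFn (fundamentalRep (Fin N)) μ) :=
  suN_massive_onBallZdW_star_bakryEmery_posWeight 20 hN (κ := κ) (t := 2 / 69) (ε₀ := 1 / 250) (ε₁ := 1 / 500) (c := 44623 / 500000)
    (lam := 1241 / 500000)
    (E := 25100200267 / 25000000000) (E₂ := 1202402401601 / 1200000000000) (s := 1238279 / 1000000) (ρ' := 999 / 1000)
    hκ (by norm_num) (by norm_num) (by norm_num) (by norm_num) ((exp_le_taylor4 (x := 1 / 250) (by norm_num) (by norm_num)).trans (by norm_num))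
    (by rw [show (1 / 250 : ℝ) / 2 = 1 / 500 by norm_num]; exact (exp_le_taylor4 (x := 1 / 500) (by norm_num) (by norm_num)).trans (by norm_num))
    (by norm_num) (by norm_num) (by norm_num) (by norm_num) (by norm_num) (by unfold doorPoly; norm_num) (by unfold gaugeR Delta; norm_num) (by norm_num)

/-- **EVERY `N ≥ 2`, EVERY `κ > 0`: every van Hove limit state is that massive DLR state**, 't Hooft `2 / 69`. [folklore] -/
theorem suN_vanHove_massive_star_2_69_posWeight (hN : 2 ≤ N) {κ : ℝ} (hκ : 0 < κ) :
    ∀ (W : Potential (ZdEdge 4) (SUN N)) (hW : MemBallZdW κ (1 / 250) (1 / 500) W),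
      ∀ μ ∈ perturbedLimitPoints ((N : ℝ) * (2 / 69)) (periodisedFamilyS W hW.dependsOn hW.gaugeInvariant hW.continuous),
        (∀ ν ∈ perturbedGibbsMeasuresS (d := 4) (fundamentalRep (Fin N)) ((N : ℝ) * (2 / 69)) W, μ = ν) ∧
          IsMassiveState μ ∧ HasExponentialDecay (plaquetteCorrFn (fundamentalRep (Fin N)) μ) := by
  intro W hW μ hμ
  obtain ⟨⟨ν, hν⟩, hall⟩ := suN_massive_onBallZdW_star_2_69_posWeight hN hκ W hW
  have hone : ∀ ν' ∈ perturbedGibbsMeasuresS (d := 4) (fundamentalRep (Fin N)) ((N : ℝ) * (2 / 69)) W, μ = ν' := fun ν' hν' =>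
    oneState_onBallZdW (suN_massGapOnBallZdW_star_2_69_posWeight hN hκ) hW hμ hν'
  exact ⟨hone, hall μ ((hone ν hν) ▸ hν)⟩

/-- **EVERY `N ≥ 2`, EVERY `κ > 0`: every DLR state MASSIVE**, `ℤ⁴`, 't Hooft `7 / 240`, ball `MemBallZdW κ (1 / 5000) (1 / 10000)` (certificate of
`suN_massGapOnBallZdW_star_7_240` verbatim); HYPOTHESIS-FREE. [folklore] -/
theorem suN_massive_onBallZdW_star_7_240_posWeight (hN : 2 ≤ N) {κ : ℝ} (hκ : 0 < κ) :
    ∀ W : Potential (ZdEdge 4) (SUN N), MemBallZdW κ (1 / 5000) (1 / 10000) W →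
      (perturbedGibbsMeasuresS (d := 4) (fundamentalRep (Fin N)) ((N : ℝ) * (7 / 240)) W).Nonempty ∧
        ∀ μ ∈ perturbedGibbsMeasuresS (d := 4) (fundamentalRep (Fin N)) ((N : ℝ) * (7 / 240)) W,
          IsMassiveState μ ∧ HasExponentialDecay (plaquetteCorrFn (fundamentalRep (Fin N)) μ) :=
  suN_massive_onBallZdW_star_bakryEmery_posWeight 20 hN (κ := κ) (t := 7 / 240) (ε₀ := 1 / 5000) (ε₁ := 1 / 10000) (c := 44881 / 500000)
    (lam := 1 / 8000)
    (E := 12002400240016001 / 12000000000000000) (E₂ := 64006400320010667 / 64000000000000000) (s := 310087 / 250000) (ρ' := 999 / 1000)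
    hκ (by norm_num) (by norm_num) (by norm_num) (by norm_num) ((exp_le_taylor4 (x := 1 / 5000) (by norm_num) (by norm_num)).trans (by norm_num))
    (by rw [show (1 / 5000 : ℝ) / 2 = 1 / 10000 by norm_num]; exact (exp_le_taylor4 (x := 1 / 10000) (by norm_num) (by norm_num)).trans (by norm_num))
    (by norm_num) (by norm_num) (by norm_num) (by norm_num) (by norm_num) (by unfold doorPoly; norm_num) (by unfold gaugeR Delta; norm_num) (by norm_num)

/-- **EVERY `N ≥ 2`, EVERY `κ > 0`: every van Hove limit state is that massive DLR state**, 't Hooft `7 / 240`. [folklore] -/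
theorem suN_vanHove_massive_star_7_240_posWeight (hN : 2 ≤ N) {κ : ℝ} (hκ : 0 < κ) :
    ∀ (W : Potential (ZdEdge 4) (SUN N)) (hW : MemBallZdW κ (1 / 5000) (1 / 10000) W),
      ∀ μ ∈ perturbedLimitPoints ((N : ℝ) * (7 / 240)) (periodisedFamilyS W hW.dependsOn hW.gaugeInvariant hW.continuous),
        (∀ ν ∈ perturbedGibbsMeasuresS (d := 4) (fundamentalRep (Fin N)) ((N : ℝ) * (7 / 240)) W, μ = ν) ∧
          IsMassiveState μ ∧ HasExponentialDecay (plaquetteCorrFn (fundamentalRep (Fin N)) μ) := by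
  intro W hW μ hμ
  obtain ⟨⟨ν, hν⟩, hall⟩ := suN_massive_onBallZdW_star_7_240_posWeight hN hκ W hW
  have hone : ∀ ν' ∈ perturbedGibbsMeasuresS (d := 4) (fundamentalRep (Fin N)) ((N : ℝ) * (7 / 240)) W, μ = ν' := fun ν' hν' =>
    oneState_onBallZdW (suN_massGapOnBallZdW_star_7_240_posWeight hN hκ) hW hμ hν'
  exact ⟨hone, hall μ ((hone ν hν) ▸ hν)⟩

end Summit.Ventures.YMGap.RobustBall

end
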